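import Mathlib
import Summits.MatrixMultiplication.MatrixMultiplication.Theorems.SnSubsetDichotomyHyperoctahedralThresholdRotationIdentity
import Summits.MatrixMultiplication.MatrixMultiplication.Theorems.SnSubsetDichotomyHyperoctahedralThresholdSameColourCollision
import Summits.MatrixMultiplication.MatrixMultiplication.Theorems.SnSubsetDichotomyHyperoctahedralThresholdInvolutiveSymmetry

/-!
# `R`-avoiding same-colour reflection structures exist (crux `HyperoctahedralThreshold`, stmt-10883)

Helper for the open core `stub_poorRigidCore` of the refutation line `refutation-local-symmetry`
(skeleton `Cruxes/HyperoctahedralThreshold/Lines/refutation_local_symmetry.lean`), siege variation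
"supply/tip dichotomy", file 2 of 2 (after `…SameColourCollision`).

Vocabulary of the line: three fixed-point-free involutions `μ c` of `Fin n`; a colour word `g : List (Fin 3)`
acts on the right, `x · g := g.foldl (fun v c => μ c v) x`.  A **same-colour reflection structure** of colour `c`
(crux NOTES §15.1) is `(a, g)` with `g ≠ []` reduced, first and last letter `≠ c`, and `μ c (a · g) = (μ c a) · g`:
the `c`-rung `{a, μ c a}` is carried by `g` onto a `c`-rung.  Its points are `a · g.take t`, `(μ c a) · g.take t`.

**SUPPLY half of the supply/tip dichotomy.**  Same-colour structures are the TIP-FREE currency of the reflection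
route: their two end rungs are edges of ONE perfect matching `M_c`, hence equal or disjoint, so the "tips" defect
of crux NOTES §9 (D2) — the only defect term of the same order as the supply — cannot occur (NOTES §15.1; the
sibling siege stub `stub_sameColourNoTips` is the formal statement).  This file proves that the tip-free supply
survives an arbitrary forbidden set:
* `structure_of_collision` (new) — a same-colour collision `v · (w 0 w⁻¹) = v · (w' 0 w'⁻¹)` of two distinct words
  of one length whose involution-word trajectories avoid `R` (supplied by `…SameColourCollision`) yields, after
  cancelling the longest common prefix `p` (`w = p ++ u`, `w' = p ++ u'`), the same-colour structure
  `a := v · w`, `g := u.reverse ++ u'`, every point of which is a trajectory point of one of the two involution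
  words, hence outside `R`;
* `exists_sameColourStructure_avoiding` — under `n(n-1) + 2^L(2L+2)|R| < 2^L n` such a structure with `|g| ≤ 2L`
  and all `2(|g|+1)` points outside `R` exists;
* `exists_sameColourStructure_avoiding_large` (= registered `stub_sameColourAvoiding`) — for all `n ≥ 2^28`, every
  host and every `|R| ≤ n^{3/4}` admit one with `2|g| + 2 ≤ n^{1/4}` (radius `L = ⌊log₂ n⌋ + 2`; elementary growth
  fact `(4k+12)^4 < 2^k` for `k ≥ 28`).
These are exactly the hypotheses of the landed extraction `stub_cleanReflection` (sibling file `…CleanReflection`,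
`c = c' = 0`) except CLEANNESS; so in the reflection currency the open core is reduced to the single statement that
SOME `R`-avoiding same-colour structure of length `≤ 2⌊log₂ n⌋ + 4` has pairwise equal-or-disjoint INTERNAL rungs —
the constant-rate local-monodromy wall (LML)/(HC) of crux NOTES §15.2–15.7, which this file does not touch.
Pure finite combinatorics plus `Real.rpow` bookkeeping; no definitions are introduced.
-/

set_option linter.dupNamespace false

namespace Summit.MatrixMultiplication.MatrixMultiplication.Theorems.HyperoctahedralThreshold.SameColourAvoiding

open Finset

variable {n : ℕ}

/-! ## From a same-colour collision to an `R`-avoiding same-colour structure (new) -/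

/-- Two distinct words of the same length split as `p ++ u`, `p ++ u'` after their longest common prefix `p`,
with `u, u'` non-empty and starting with different letters. -/
theorem common_prefix : ∀ (w w' : List (Fin 3)), w ≠ w' → w.length = w'.length →
    ∃ p u u' : List (Fin 3), w = p ++ u ∧ w' = p ++ u' ∧ u ≠ [] ∧ u' ≠ [] ∧
      ∀ x ∈ u.head?, ∀ y ∈ u'.head?, x ≠ y := by
  intro w
  induction w with
  | nil =>
    intro w' hne hlen
    cases w' with
    | nil => exact absurd rfl hne
    | cons _ _ => simp at hlen
  | cons x w₀ ih =>
    intro w' hne hlen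
    cases w' with
    | nil => simp at hlen
    | cons x' w₀' =>
      by_cases hx : x = x'
      · subst hx
        have hne' : w₀ ≠ w₀' := fun h => hne (by rw [h])
        obtain ⟨p, u, u', rfl, rfl, hu, hu', hh⟩ := ih w₀' hne' (by simpa using hlen)
        exact ⟨x :: p, u, u', rfl, rfl, hu, hu', hh⟩
      · refine ⟨[], x :: w₀, x' :: w₀', rfl, rfl, List.cons_ne_nil _ _, List.cons_ne_nil _ _, ?_⟩
        intro a ha b hb
        simp only [List.head?_cons, Option.mem_def, Option.some.injEq] at ha hb
        rw [← ha, ← hb]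
        exact hx

/-- Trajectory points of the involution word `w ++ 0 :: w.reverse` at times `j ≤ |w|` … -/
theorem traj_fst (μ : Fin 3 → Equiv.Perm (Fin n)) (w : List (Fin 3)) (v : Fin n) {j : ℕ}
    (hj : j ≤ w.length) :
    ((w ++ 0 :: w.reverse).take j).foldl (fun v c => μ c v) v = (w.take j).foldl (fun v c => μ c v) v := by
  rw [List.take_append_of_le_length hj]

/-- … and at times `|w| + 1 + j`. -/
theorem traj_snd (μ : Fin 3 → Equiv.Perm (Fin n)) (w : List (Fin 3)) (v : Fin n) (j : ℕ) :
    ((w ++ 0 :: w.reverse).take (w.length + 1 + j)).foldl (fun v c => μ c v) v =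
      (w.reverse.take j).foldl (fun v c => μ c v) (μ 0 (w.foldl (fun v c => μ c v) v)) := by
  rw [List.take_append, List.take_of_length_le (Nat.le_add_right_of_le (Nat.le_succ _)),
    show w.length + 1 + j - w.length = j + 1 by omega, List.take_succ_cons, List.foldl_append,
    List.foldl_cons]

/-- Splitting a reversed word at `s`: walk back over `l.drop s` first, then over `l.take s`. -/
theorem foldl_reverse_split {α β : Type*} (f : β → α → β) (x : β) (l : List α) (s : ℕ) :
    l.reverse.foldl f x = (l.take s).reverse.foldl f ((l.drop s).reverse.foldl f x) := by
  conv_lhs => rw [← List.take_append_drop s l]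
  rw [List.reverse_append, List.foldl_append]

/-- **Extraction.**  A same-colour collision `v · (w 0 w⁻¹) = v · (w' 0 w'⁻¹)` of two distinct words of length
`L` (`w ++ [0]`, `w' ++ [0]` reduced) whose involution-word trajectories from `v` avoid `R` yields a same-colour
reflection structure `(a, g)` of colour `0` — `g ≠ []` reduced, `|g| ≤ 2L`, first and last letter `≠ 0`,
`μ 0 (a · g) = (μ 0 a) · g` — all of whose points `a · g.take t`, `(μ 0 a) · g.take t` (`t ≤ |g|`) avoid `R`.
Construction: `w = p ++ u`, `w' = p ++ u'` (longest common prefix), `a := v · w`, `g := u.reverse ++ u'`. -/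
theorem structure_of_collision (μ : Fin 3 → Equiv.Perm (Fin n)) (hμ : ∀ c, μ c * μ c = 1)
    (R : Finset (Fin n)) {L : ℕ} {v : Fin n} {w w' : List (Fin 3)} (hne : w ≠ w')
    (hlw : w.length = L) (hlw' : w'.length = L)
    (hcw : List.IsChain (· ≠ ·) (w ++ [0])) (hcw' : List.IsChain (· ≠ ·) (w' ++ [0]))
    (hcoll : (w ++ 0 :: w.reverse).foldl (fun v c => μ c v) v =
      (w' ++ 0 :: w'.reverse).foldl (fun v c => μ c v) v)
    (hR : ∀ t, ((w ++ 0 :: w.reverse).take t).foldl (fun v c => μ c v) v ∉ R)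
    (hR' : ∀ t, ((w' ++ 0 :: w'.reverse).take t).foldl (fun v c => μ c v) v ∉ R) :
    ∃ (a : Fin n) (g : List (Fin 3)), g ≠ [] ∧ g.length ≤ 2 * L ∧ List.IsChain (· ≠ ·) g ∧
      g.head? ≠ some 0 ∧ g.getLast? ≠ some 0 ∧
      μ 0 (g.foldl (fun v c => μ c v) a) = g.foldl (fun v c => μ c v) (μ 0 a) ∧
      ∀ t ≤ g.length, (g.take t).foldl (fun v c => μ c v) a ∉ R ∧
        (g.take t).foldl (fun v c => μ c v) (μ 0 a) ∉ R := by
  obtain ⟨p, u, u', rfl, rfl, hune, hune', hhd⟩ := common_prefix w w' hne (hlw.trans hlw'.symm)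
  simp only [List.length_append] at hlw hlw'
  have hcu : List.IsChain (· ≠ ·) u :=
    (List.isChain_append.1 (List.isChain_append.1 hcw).1).2.1
  have hcu' : List.IsChain (· ≠ ·) u' :=
    (List.isChain_append.1 (List.isChain_append.1 hcw').1).2.1
  have hlast : u.getLast? ≠ some 0 := by
    intro h0
    have hj := (List.isChain_append.1 hcw).2.2
    rw [List.getLast?_append_of_ne_nil _ hune] at hj
    exact hj 0 (by rw [h0]; rfl) 0 (by simp) rfl
  have hlast' : u'.getLast? ≠ some 0 := by
    intro h0
    have hj := (List.isChain_append.1 hcw').2.2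
    rw [List.getLast?_append_of_ne_nil _ hune'] at hj
    exact hj 0 (by rw [h0]; rfl) 0 (by simp) rfl
  -- (★) cancel `p.reverse` in the collision (everything in nested-`foldl` normal form)
  have key : u.reverse.foldl (fun v c => μ c v) (μ 0 (u.foldl (fun v c => μ c v)
      (p.foldl (fun v c => μ c v) v))) = u'.reverse.foldl (fun v c => μ c v)
        (μ 0 (u'.foldl (fun v c => μ c v) (p.foldl (fun v c => μ c v) v))) := by
    simp only [List.foldl_append, List.foldl_cons, List.reverse_append] at hcoll
    exact Rotation.foldl_act_injective μ hμ p.reverse hcoll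
  refine ⟨(p ++ u).foldl (fun v c => μ c v) v, u.reverse ++ u', by simp [hune'], ?_, ?_, ?_, ?_, ?_, ?_⟩
  · -- length
    rw [List.length_append, List.length_reverse]; omega
  · -- reduced
    refine List.isChain_append.2 ⟨?_, hcu', ?_⟩
    · rw [List.isChain_reverse]; exact hcu.imp (fun a b h => Ne.symm h)
    · intro x hx y hy
      rw [List.getLast?_reverse] at hx
      exact hhd x hx y hy
  · -- first letter
    rw [List.head?_append_of_ne_nil _ (by simpa using hune), List.head?_reverse]; exact hlast
  · -- last letter
    rw [List.getLast?_append_of_ne_nil _ hune']; exact hlast'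
  · -- structure equation: both sides equal `μ 0 a'`, `a' = v · w'`
    simp only [List.foldl_append]
    rw [Rotation.foldl_act_reverse μ hμ, key, Rotation.foldl_reverse_act μ hμ]
  · -- avoidance
    intro t ht
    rw [List.length_append, List.length_reverse] at ht
    by_cases htu : t ≤ u.length
    · rw [List.take_append_of_le_length (by simpa using htu)]
      simp only [List.foldl_append]
      constructor
      · -- `a · (u⁻¹.take t) = v · w.take (|p| + (|u| - t))`
        rw [InvolutiveSymmetry.foldl_reverse_take μ hμ]
        have h1 := hR (p.length + (u.length - t))
        rw [traj_fst μ _ _ (by rw [List.length_append]; omega), List.take_append,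
          List.take_of_length_le (Nat.le_add_right _ _), Nat.add_sub_cancel_left, List.foldl_append] at h1
        exact h1
      · -- `(μ 0 a) · (u⁻¹.take t)` is the point of `ι` at time `|w| + 1 + t`
        have h2 := hR ((p ++ u).length + 1 + t)
        rw [traj_snd, List.reverse_append, List.take_append_of_le_length (by simpa using htu)] at h2
        simp only [List.foldl_append] at h2
        exact h2
    · push Not at htu
      obtain ⟨s, rfl⟩ : ∃ s, t = u.length + s := ⟨t - u.length, by omega⟩
      have hs : s ≤ u'.length := by omega
      rw [List.take_append, List.take_of_length_le (by rw [List.length_reverse]; omega),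
        List.length_reverse, Nat.add_sub_cancel_left]
      simp only [List.foldl_append]
      constructor
      · -- `a · u⁻¹ · (u'.take s) = v · w'.take (|p| + s)`
        rw [Rotation.foldl_act_reverse μ hμ]
        have h1 := hR' (p.length + s)
        rw [traj_fst μ _ _ (by rw [List.length_append]; omega), List.take_append,
          List.take_of_length_le (Nat.le_add_right _ _), Nat.add_sub_cancel_left, List.foldl_append] at h1
        exact h1
      · -- `(μ 0 a) · u⁻¹ · (u'.take s)` is the point of `ι'` at time `|w'| + 1 + (|u'| - s)`
        rw [key, foldl_reverse_split _ _ u' s, Rotation.foldl_reverse_act μ hμ]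
        have h2 := hR' ((p ++ u').length + 1 + (u'.length - s))
        rw [traj_snd, List.reverse_append,
          List.take_append_of_le_length (by rw [List.length_reverse]; omega), List.take_reverse,
          show u'.length - (u'.length - s) = s by omega] at h2
        simp only [List.foldl_append] at h2
        exact h2

/-- **`R`-avoiding same-colour reflection structures exist** (supply half of the supply/tip dichotomy).  For three
fixed-point-free involutions of `Fin n`, a forbidden set `R` and a radius `L` with `n(n-1) + 2^L(2L+2)|R| < 2^L n`,
there is a same-colour reflection structure `(a, g)` of colour `0` with `|g| ≤ 2L` — `g ≠ []` reduced, first and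
last letter `≠ 0`, `μ 0 (a · g) = (μ 0 a) · g` — all of whose `2(|g| + 1)` points avoid `R`.  Its end rungs
`{a, μ 0 a}` and `{a · g, (μ 0 a) · g}` are edges of the matching `M_0`, hence equal or disjoint (no "tips"). -/
theorem exists_sameColourStructure_avoiding (μ : Fin 3 → Equiv.Perm (Fin n)) (hμ : ∀ c, μ c * μ c = 1)
    (hfpf : ∀ c v, μ c v ≠ v) {L : ℕ} (R : Finset (Fin n))
    (hL : n * (n - 1) + 2 ^ L * ((2 * L + 2) * R.card) < 2 ^ L * n) :
    ∃ (a : Fin n) (g : List (Fin 3)), g ≠ [] ∧ g.length ≤ 2 * L ∧ List.IsChain (· ≠ ·) g ∧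
      g.head? ≠ some 0 ∧ g.getLast? ≠ some 0 ∧
      μ 0 (g.foldl (fun v c => μ c v) a) = g.foldl (fun v c => μ c v) (μ 0 a) ∧
      ∀ t ≤ g.length, (g.take t).foldl (fun v c => μ c v) a ∉ R ∧
        (g.take t).foldl (fun v c => μ c v) (μ 0 a) ∉ R := by
  obtain ⟨v, w, w', hne, hlw, hlw', hcw, hcw', hcoll, hR, hR'⟩ :=
    SameColourCollision.exists_sameColour_collision_avoiding μ hμ hfpf R hL
  exact structure_of_collision μ hμ R hne hlw hlw' hcw hcw' hcoll hR hR'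

/-! ## At the scale of the core: `|R| ≤ n^{3/4}`, structures of length `O(log n) ≤ n^{1/4}` -/

/-- Growth fact: `(4k + 12)^4 < 2^k` for `k ≥ 28`. -/
theorem pow_four_lt_two_pow {k : ℕ} (hk : 28 ≤ k) : (4 * k + 12) ^ 4 < 2 ^ k := by
  induction k, hk using Nat.le_induction with
  | base => norm_num
  | succ k hk ih =>
    have hstep : (4 * (k + 1) + 12) ^ 4 ≤ 2 * (4 * k + 12) ^ 4 := by
      have hm : 124 ≤ 4 * k + 12 := by omega
      obtain ⟨m, hm', hmk⟩ : ∃ m, 124 ≤ m ∧ 4 * k + 12 = m := ⟨_, hm, rfl⟩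
      rw [show 4 * (k + 1) + 12 = m + 4 by omega, hmk]
      have h1 : 124 * m ^ 3 ≤ m ^ 4 := by
        calc 124 * m ^ 3 ≤ m * m ^ 3 := Nat.mul_le_mul_right _ hm'
          _ = m ^ 4 := by ring
      have h2 : 96 * m ^ 2 + 256 * m + 256 ≤ 108 * m ^ 3 := by
        have hm1 : 1 ≤ m ^ 2 := Nat.one_le_pow _ _ (by omega)
        have hm2 : m ≤ m ^ 2 := by nlinarith
        have hm3 : 124 * m ^ 2 ≤ m ^ 3 := by
          calc 124 * m ^ 2 ≤ m * m ^ 2 := Nat.mul_le_mul_right _ hm'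
            _ = m ^ 3 := by ring
        linarith
      calc (m + 4) ^ 4 = m ^ 4 + (16 * m ^ 3 + (96 * m ^ 2 + 256 * m + 256)) := by ring
        _ ≤ m ^ 4 + (16 * m ^ 3 + 108 * m ^ 3) := by linarith [h2]
        _ = m ^ 4 + 124 * m ^ 3 := by ring
        _ ≤ m ^ 4 + m ^ 4 := by linarith [h1]
        _ = 2 * m ^ 4 := by ring
    calc (4 * (k + 1) + 12) ^ 4 ≤ 2 * (4 * k + 12) ^ 4 := hstep
      _ < 2 * 2 ^ k := by linarith [ih]
      _ = 2 ^ (k + 1) := by ring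

/-- From `x ^ 4 ≤ n` (naturals) to `x ≤ n ^ (1/4)` (reals). -/
theorem le_rpow_quarter_of_pow_four_le {x n : ℕ} (h : x ^ 4 ≤ n) : (x : ℝ) ≤ (n : ℝ) ^ ((1 : ℝ) / 4) := by
  have hx : (0 : ℝ) ≤ x := Nat.cast_nonneg x
  have h' : ((x : ℝ) ^ 4) ≤ (n : ℝ) := by exact_mod_cast h
  calc (x : ℝ) = ((x : ℝ) ^ 4) ^ ((4 : ℕ)⁻¹ : ℝ) := (Real.pow_rpow_inv_natCast hx (by norm_num)).symm
    _ ≤ (n : ℝ) ^ ((4 : ℕ)⁻¹ : ℝ) := Real.rpow_le_rpow (by positivity) h' (by positivity)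
    _ = (n : ℝ) ^ ((1 : ℝ) / 4) := by norm_num

/-- From `|R| ≤ n ^ (3/4)` (reals) to `|R| ^ 4 ≤ n ^ 3` (naturals). -/
theorem pow_four_le_cube_of_le_rpow {r n : ℕ} (h : (r : ℝ) ≤ (n : ℝ) ^ ((3 : ℝ) / 4)) : r ^ 4 ≤ n ^ 3 := by
  have hn : (0 : ℝ) ≤ n := Nat.cast_nonneg n
  have h4 : ((r : ℝ)) ^ (4 : ℕ) ≤ ((n : ℝ) ^ ((3 : ℝ) / 4)) ^ (4 : ℕ) :=
    pow_le_pow_left₀ (Nat.cast_nonneg r) h 4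
  rw [← Real.rpow_natCast ((n : ℝ) ^ ((3 : ℝ) / 4)), ← Real.rpow_mul hn] at h4
  norm_num at h4
  exact_mod_cast h4


/-- **Supply at the scale of the core.**  For all large `n`, three fixed-point-free involutions of `Fin n` and any
forbidden set with `|R| ≤ n^{3/4}` admit a same-colour reflection structure `(a, g)` of colour `0`, all of whose points
avoid `R`, with `2|g| + 2 ≤ n^{1/4}` — i.e. every hypothesis of the landed extraction `stub_cleanReflection`
(sibling file `…CleanReflection`, with `c = c' = 0`) except CLEANNESS, whose conclusion is that of `stub_poorRigidCore`.
(Radius `L = ⌊log₂ n⌋ + 2`, so `2n < 2^L ≤ 4n`; the numeric side condition reduces to `(4L + 4)|R| < n` and the length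
clause to `(4L + 4)^4 ≤ n`, both from `(4L+4)^4 < 2^{L-2} ≤ n` for `L - 2 ≥ 28`.) -/
theorem exists_sameColourStructure_avoiding_large :
    ∃ n₀ : ℕ, ∀ n ≥ n₀, ∀ μ : Fin 3 → Equiv.Perm (Fin n), (∀ i, μ i * μ i = 1 ∧ ∀ v, μ i v ≠ v) →
      ∀ R : Finset (Fin n), (R.card : ℝ) ≤ (n : ℝ) ^ ((3 : ℝ) / 4) →
      ∃ (a : Fin n) (g : List (Fin 3)), g ≠ [] ∧ List.IsChain (· ≠ ·) g ∧
        (∀ e ∈ g.head?, e ≠ 0) ∧ (∀ e ∈ g.getLast?, e ≠ 0) ∧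
        μ 0 (g.foldl (fun v c => μ c v) a) = g.foldl (fun v c => μ c v) (μ 0 a) ∧
        (∀ t ≤ g.length, (g.take t).foldl (fun v c => μ c v) a ∉ R ∧
          (g.take t).foldl (fun v c => μ c v) (μ 0 a) ∉ R) ∧
        (2 * (g.length : ℝ) + 2) ≤ (n : ℝ) ^ ((1 : ℝ) / 4) := by
  refine ⟨2 ^ 28, fun n hn μ hμ R hR => ?_⟩
  have hn0 : n ≠ 0 := by intro h; rw [h] at hn; exact absurd hn (by norm_num)
  obtain ⟨k, hk⟩ : ∃ k, Nat.log 2 n = k := ⟨_, rfl⟩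
  have hk28 : 28 ≤ k := hk ▸ Nat.le_log_of_pow_le (by norm_num) hn
  have h2k : 2 ^ k ≤ n := hk ▸ Nat.pow_log_le_self 2 hn0
  have hn2k : n < 2 * 2 ^ k := by
    have := Nat.lt_pow_succ_log_self (b := 2) (by norm_num) n
    rw [hk, pow_succ] at this
    linarith
  have hgrow : (4 * k + 12) ^ 4 < n := lt_of_lt_of_le (pow_four_lt_two_pow hk28) h2k
  have hR4 : R.card ^ 4 ≤ n ^ 3 := pow_four_le_cube_of_le_rpow hR
  -- `(4k + 12) |R| < n`
  have hprod : (4 * k + 12) * R.card < n := by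
    have h4 : ((4 * k + 12) * R.card) ^ 4 < n ^ 4 := by
      calc ((4 * k + 12) * R.card) ^ 4 = (4 * k + 12) ^ 4 * R.card ^ 4 := by ring
        _ ≤ (4 * k + 12) ^ 4 * n ^ 3 := Nat.mul_le_mul_left _ hR4
        _ < n * n ^ 3 := Nat.mul_lt_mul_of_pos_right hgrow (by positivity)
        _ = n ^ 4 := by ring
    exact (Nat.pow_lt_pow_iff_left (by norm_num)).1 h4
  -- the numeric hypothesis of the supply at radius `L = k + 2`
  have hL : n * (n - 1) + 2 ^ (k + 2) * ((2 * (k + 2) + 2) * R.card) < 2 ^ (k + 2) * n := by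
    have h3 : n * (n - 1) ≤ n * n := Nat.mul_le_mul_left _ (Nat.sub_le _ _)
    have hA : n * n ≤ n * (2 * 2 ^ k) := Nat.mul_le_mul_left _ hn2k.le
    have hB : 2 ^ k * (2 * ((2 * (k + 2) + 2) * R.card)) < 2 ^ k * n := by
      refine Nat.mul_lt_mul_of_pos_left ?_ (by positivity)
      have : 2 * ((2 * (k + 2) + 2) * R.card) = (4 * k + 12) * R.card := by ring
      omega
    have e1 : 2 ^ (k + 2) = 4 * 2 ^ k := by ring
    rw [e1]
    nlinarith [h3, hA, hB]
  obtain ⟨a, g, hg, hlen, hch, hh, hl, hs, hav⟩ :=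
    exists_sameColourStructure_avoiding μ (fun c => (hμ c).1) (fun c v => (hμ c).2 v) R hL
  refine ⟨a, g, hg, hch, ?_, ?_, hs, hav, ?_⟩
  · intro e he h0
    subst h0
    exact hh (Option.mem_def.1 he)
  · intro e he h0
    subst h0
    exact hl (Option.mem_def.1 he)
  · have h5 : (2 * g.length + 2) ^ 4 ≤ n := by
      calc (2 * g.length + 2) ^ 4 ≤ (4 * k + 12) ^ 4 := Nat.pow_le_pow_left (by omega) 4
        _ ≤ n := hgrow.le
    have h6 := le_rpow_quarter_of_pow_four_le h5
    push_cast at h6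
    exact h6

/-- **Registered form** (`stub_sameColourAvoiding`, a `--supports` sub-goal of crux stmt-MatrixMultiplication-10883,
siege variation "supply/tip dichotomy"): verbatim `exists_sameColourStructure_avoiding_large`. -/
theorem stub_sameColourAvoiding : ∃ n₀ : ℕ, ∀ n ≥ n₀, ∀ μ : Fin 3 → Equiv.Perm (Fin n), (∀ i, μ i * μ i = 1 ∧ ∀ v, μ i v ≠ v) → ∀ R : Finset (Fin n), (R.card : ℝ) ≤ (n : ℝ) ^ ((3 : ℝ) / 4) → ∃ (a : Fin n) (g : List (Fin 3)), g ≠ [] ∧ List.IsChain (· ≠ ·) g ∧ (∀ e ∈ g.head?, e ≠ 0) ∧ (∀ e ∈ g.getLast?, e ≠ 0) ∧ μ 0 (g.foldl (fun v c => μ c v) a) = g.foldl (fun v c => μ c v) (μ 0 a) ∧ (∀ t ≤ g.length, (g.take t).foldl (fun v c => μ c v) a ∉ R ∧ (g.take t).foldl (fun v c => μ c v) (μ 0 a) ∉ R) ∧ (2 * (g.length : ℝ) + 2) ≤ (n : ℝ) ^ ((1 : ℝ) / 4) :=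
  exists_sameColourStructure_avoiding_large

end Summit.MatrixMultiplication.MatrixMultiplication.Theorems.HyperoctahedralThreshold.SameColourAvoiding
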